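import Mathlib.AlgebraicTopology.FundamentalGroupoid.SimplyConnected
import Mathlib.Topology.Subpath
import Mathlib.Topology.UnitInterval
import Mathlib.Analysis.Convex.Contractible
import Mathlib.Analysis.Normed.Module.Connected
import Mathlib.Geometry.Manifold.Instances.Sphere
import HarnessLib

/-!
# The sphere `Sⁿ` is simply connected for `n ≥ 2` (Hatcher, Prop. 1.14) — proved

Topic `Literature/AlgebraicTopology/FundamentalGroup`. Discharges the named fact
`Literature.Riemannian.sphere_simplyConnected` used in the decomposition of Kuiper's theorem
(`Literature/Geometry/Riemannian/KuiperProofs.lean`); Mathlib (v4.32) has no `π₁(Sⁿ)`.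

## Content (all proved)

* `Path.Homotopic.refl_of_isOpen_cover` — **Hatcher 2002, Lemma 1.15 (trivial-`π₁` form)**: if
  `X = ⋃ i, c i` with each `c i` open and simply connected, all containing `x₀`, and all pairwise
  intersections `c i ∩ c j` path connected, then every loop at `x₀` is null-homotopic.
* `simplyConnectedSpace_of_loops_nullhomotopic_at` — one base point suffices.
* `simplyConnectedSpace_of_isOpen_cover` — the union statement (van Kampen with trivial groups).
* `simplyConnectedSpace_sphere` — **Hatcher 2002, Prop. 1.14**: the unit sphere in
  `EuclideanSpace ℝ (Fin (n + 1))` is simply connected for `2 ≤ n` (cover by the complements of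
  two antipodal points, each homeomorphic to `ℝⁿ` by stereographic projection, with intersection
  `≅ ℝⁿ ∖ {0}` path connected for `n ≥ 2`).

## References

* A. Hatcher, *Algebraic Topology*, CUP 2002, Prop. 1.14 and Lemma 1.15.
-/

noncomputable section

open Set Function unitInterval Topology
open scoped Manifold

namespace Literature.AlgebraicTopology.FundamentalGroup

variable {X : Type*} [TopologicalSpace X]

/-! ### Hatcher's Lemma 1.15 with trivial fundamental groups -/

section Cover

open Path.Homotopic.Quotient in
/-- Auxiliary: transporting the end point of the two paths in `⟦p⟧ · ⟦g⟧⁻¹` along an equality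
does not change the product. [folklore] -/
private theorem mk_cast_trans_symm_mk_cast {x y y' : X} (p g : Path x y) (hy : y' = y) :
    (mk (p.cast rfl hy)).trans (mk (g.cast rfl hy)).symm = (mk p).trans (mk g).symm := by
  subst hy; rfl

open Path.Homotopic.Quotient in
/-- **Hatcher 2002, Lemma 1.15 (for simply connected pieces).** If `X` is covered by open, simply
connected sets `c i` all containing `x₀` and with pairwise path-connected intersections, then
every loop at `x₀` is homotopic to the constant loop. Proof as printed: a Lebesgue-number
partition `0 = t₀ ≤ … ≤ t_m = 1` with `γ [t_k, t_{k+1}] ⊆ c (i_k)`; connect `x₀` to `γ t_k`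
inside `c (i_{k-1}) ∩ c (i_k)` by `g_k`; then `γ ≃ ∏ₖ (g_k · γ|[t_k,t_{k+1}] · g_{k+1}⁻¹)`, each
factor a loop in the simply connected `c (i_k)`. [cite: HatcherAT2002, Lemma 1.15] -/
theorem _root_.Path.Homotopic.refl_of_isOpen_cover {ι : Type*} {c : ι → Set X}
    (hco : ∀ i, IsOpen (c i)) (hcov : ⋃ i, c i = univ) (hsc : ∀ i, IsSimplyConnected (c i))
    (hpc : ∀ i j, IsPathConnected (c i ∩ c j)) {x₀ : X} (hx₀ : ∀ i, x₀ ∈ c i) (γ : Path x₀ x₀) :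
    γ.Homotopic (Path.refl x₀) := by
  classical
  -- null-homotopy of loops inside a single piece
  have hnull : ∀ i {y : X} (p : Path y y), (∀ s, p s ∈ c i) → mk p = Path.Homotopic.Quotient.refl y := by
    intro i y p hp
    obtain ⟨F, -⟩ := (isSimplyConnected_iff_exists_homotopy_refl_forall_mem.mp (hsc i)).2 y p hp
    rw [← mk_refl]
    exact Path.Homotopic.Quotient.eq.mpr ⟨F⟩
  -- Lebesgue partition of `I` subordinate to `γ ⁻¹' c i`
  have hc₁ : ∀ i, IsOpen (γ ⁻¹' c i) := fun i => (hco i).preimage γ.continuous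
  have hc₂ : (univ : Set I) ⊆ ⋃ i, γ ⁻¹' c i := by
    intro s _
    have : γ s ∈ ⋃ i, c i := hcov ▸ mem_univ _
    simpa only [mem_iUnion, mem_preimage] using this
  obtain ⟨t, ht0, htmono, ⟨m, hm⟩, hsub⟩ :=
    exists_monotone_Icc_subset_open_cover_unitInterval hc₁ hc₂
  choose idx hidx using hsub
  have hγmem : ∀ k, ∀ s ∈ Icc (t k) (t (k + 1)), γ s ∈ c (idx k) := fun k s hs => hidx k hs
  -- the pieces `P k = γ|[0, t k]` re-based at `x₀`
  set P : ∀ k, Path x₀ (γ (t k)) := fun k => (γ.subpath 0 (t k)).cast γ.source.symm rfl with hP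
  -- the inductive claim
  have claim : ∀ k, ∃ g : Path x₀ (γ (t k)), (∀ s, g s ∈ c (idx k)) ∧
      (mk (P k)).trans (mk g).symm = Path.Homotopic.Quotient.refl x₀ := by
    have h0I : ∀ u : I, (0 : I) ≤ u := fun u => u.2.1
    have ht0u : ∀ u : I, t 0 ≤ u := fun u => by rw [ht0]; exact h0I u
    have hx₀' : ∀ i, γ 0 ∈ c i := fun i => by rw [γ.source]; exact hx₀ i
    intro k
    induction k with
    | zero =>
      refine ⟨P 0, fun s => ?_, by simp⟩
      have hs : (P 0) s ∈ range (γ.subpath 0 (t 0)) := ⟨s, rfl⟩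
      rw [Path.range_subpath_of_le γ 0 (t 0) (h0I _)] at hs
      obtain ⟨u, hu, hus⟩ := hs
      rw [← hus]
      exact hγmem 0 u ⟨ht0u u, hu.2.trans (htmono (Nat.le_succ 0))⟩
    | succ k ih =>
      obtain ⟨g, hg, hS⟩ := ih
      -- the end point `γ (t (k+1))` lies in both pieces
      have hy₁ : γ (t (k + 1)) ∈ c (idx k) := hγmem k _ ⟨htmono (Nat.le_succ k), le_rfl⟩
      have hy₂ : γ (t (k + 1)) ∈ c (idx (k + 1)) :=
        hγmem (k + 1) _ ⟨le_rfl, htmono (Nat.le_succ (k + 1))⟩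
      -- connect `x₀` to it inside the intersection
      have hJ : JoinedIn (c (idx k) ∩ c (idx (k + 1))) x₀ (γ (t (k + 1))) :=
        (hpc _ _).joinedIn x₀ ⟨hx₀ _, hx₀ _⟩ _ ⟨hy₁, hy₂⟩
      set g' : Path x₀ (γ (t (k + 1))) := hJ.somePath with hg'
      have hg'mem : ∀ s, g' s ∈ c (idx k) ∩ c (idx (k + 1)) := hJ.somePath_mem
      -- the `k`-th piece of `γ`
      set q : Path (γ (t k)) (γ (t (k + 1))) := γ.subpath (t k) (t (k + 1)) with hq
      have hqmem : ∀ s, q s ∈ c (idx k) := by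
        intro s
        have hs : q s ∈ range q := ⟨s, rfl⟩
        rw [hq, Path.range_subpath_of_le _ _ _ (htmono (Nat.le_succ k))] at hs
        obtain ⟨u, hu, hus⟩ := hs
        exact hus ▸ hγmem k u hu
      -- the loop `g · q · g'⁻¹` lies in `c (idx k)`, hence is trivial
      have hloop : mk ((g.trans q).trans g'.symm) = Path.Homotopic.Quotient.refl x₀ := by
        refine hnull (idx k) _ fun s => ?_
        have hs : ((g.trans q).trans g'.symm) s ∈ range ((g.trans q).trans g'.symm) := ⟨s, rfl⟩
        rw [Path.trans_range, Path.trans_range, Path.symm_range] at hs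
        rcases hs with (⟨u, hu⟩ | ⟨u, hu⟩) | ⟨u, hu⟩
        exacts [hu ▸ hg u, hu ▸ hqmem u, hu ▸ (hg'mem u).1]
      -- `P (k+1) ≃ P k · q`
      have hPsucc : mk (P (k + 1)) = (mk (P k)).trans (mk q) := by
        have h1 : ((γ.subpath 0 (t k)).trans q).Homotopic (γ.subpath 0 (t (k + 1))) :=
          ⟨Path.Homotopy.subpathTransSubpath γ 0 (t k) (t (k + 1))⟩
        have h2 := h1.pathCast γ.source.symm rfl
        rw [Path.cast_trans _ _ γ.source.symm rfl rfl, Path.cast_rfl_rfl] at h2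
        rw [← mk_trans]
        exact (Path.Homotopic.Quotient.eq.mpr h2).symm
      refine ⟨g', fun s => (hg'mem s).2, ?_⟩
      simp only [mk_trans, mk_symm] at hloop
      calc (mk (P (k + 1))).trans (mk g').symm
          = (((mk (P k)).trans (mk g).symm).trans
              (((mk g).trans (mk q)).trans (mk g').symm)) := by
            rw [hPsucc]
            simp only [trans_assoc]
            rw [← Path.Homotopic.Quotient.trans_assoc (mk g).symm (mk g),
              Path.Homotopic.Quotient.symm_trans, Path.Homotopic.Quotient.refl_trans]
        _ = Path.Homotopic.Quotient.refl x₀ := by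
            rw [hS, hloop, Path.Homotopic.Quotient.refl_trans]
  -- conclusion at `k = m`, where `t m = 1`
  obtain ⟨g, hg, hS⟩ := claim m
  have hfin : ∀ (b : I) (g : Path x₀ (γ b)), (∀ s, g s ∈ c (idx m)) →
      (mk ((γ.subpath 0 b).cast γ.source.symm rfl)).trans (mk g).symm =
        Path.Homotopic.Quotient.refl x₀ → b = 1 →
      γ.Homotopic (Path.refl x₀) := by
    intro b g hg hS hb
    subst hb
    -- re-base the end point `γ 1` at `x₀`
    have hgl0 : mk (g.cast rfl γ.target.symm) = Path.Homotopic.Quotient.refl x₀ :=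
      hnull (idx m) (g.cast rfl γ.target.symm) fun s => hg s
    have hQ : ((γ.subpath 0 1).cast γ.source.symm rfl).cast rfl γ.target.symm = γ := by
      ext s
      simp [Path.subpath]
    have key := mk_cast_trans_symm_mk_cast ((γ.subpath 0 1).cast γ.source.symm rfl) g
      γ.target.symm
    rw [hS, hQ, hgl0, ← mk_refl, ← mk_symm, Path.refl_symm, mk_refl,
      Path.Homotopic.Quotient.trans_refl] at key
    exact Path.Homotopic.Quotient.eq.mp key
  exact hfin (t m) g hg hS (hm m le_rfl)

end Cover

/-! ### One base point suffices; simply connected open covers -/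

section OneBasepoint

open Path.Homotopic.Quotient in
/-- If `X` is path connected and every loop at one point `x₀` is null-homotopic, then `X` is
simply connected (change of base point: a loop `γ` at `x` is conjugate, in the fundamental
groupoid, to the loop `p · γ · p⁻¹` at `x₀` for a path `p` from `x₀` to `x`). [folklore] -/
theorem simplyConnectedSpace_of_loops_nullhomotopic_at [PathConnectedSpace X] (x₀ : X)
    (h : ∀ γ : Path x₀ x₀, γ.Homotopic (Path.refl x₀)) : SimplyConnectedSpace X := by
  refine simply_connected_iff_loops_nullhomotopic.mpr ⟨inferInstance, fun x γ => ?_⟩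
  set p : Path x₀ x := PathConnectedSpace.somePath x₀ x
  have key : ((mk p).trans (mk γ)).trans (mk p).symm = Path.Homotopic.Quotient.refl x₀ := by
    rw [← mk_symm, ← mk_trans, ← mk_trans, ← mk_refl]
    exact Path.Homotopic.Quotient.eq.mpr (h _)
  rw [← Path.Homotopic.Quotient.eq, mk_refl]
  calc mk γ = ((mk p).symm.trans (((mk p).trans (mk γ)).trans (mk p).symm)).trans (mk p) := by
          simp only [trans_assoc, symm_trans, trans_refl]
          rw [← trans_assoc, symm_trans, refl_trans]
    _ = Path.Homotopic.Quotient.refl x := by rw [key, trans_refl, symm_trans]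

/-- **Hatcher 2002, Lemma 1.15 (van Kampen with trivial groups).** If `X` is covered by open,
simply connected sets `c i` all containing a common point `x₀` and with pairwise path-connected
intersections, then `X` is simply connected. [cite: HatcherAT2002, Lemma 1.15] -/
theorem simplyConnectedSpace_of_isOpen_cover {ι : Type*} {c : ι → Set X}
    (hco : ∀ i, IsOpen (c i)) (hcov : ⋃ i, c i = univ) (hsc : ∀ i, IsSimplyConnected (c i))
    (hpc : ∀ i j, IsPathConnected (c i ∩ c j)) {x₀ : X} (hx₀ : ∀ i, x₀ ∈ c i) :
    SimplyConnectedSpace X := by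
  haveI : PathConnectedSpace X := by
    rw [pathConnectedSpace_iff_univ]
    refine ⟨x₀, mem_univ _, fun y _ => ?_⟩
    have hy : y ∈ ⋃ i, c i := hcov ▸ mem_univ y
    obtain ⟨i, hi⟩ := mem_iUnion.mp hy
    exact ((hsc i).isPathConnected.joinedIn x₀ (hx₀ i) y hi).mono (subset_univ _)
  exact simplyConnectedSpace_of_loops_nullhomotopic_at x₀
    (Path.Homotopic.refl_of_isOpen_cover hco hcov hsc hpc hx₀)

end OneBasepoint

/-! ### The sphere -/

section Sphere

variable {E : Type*} [NormedAddCommGroup E] [InnerProductSpace ℝ E]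

/-- The complement of a point `v` in the unit sphere of a real inner product space is simply
connected: stereographic projection from `v` is a homeomorphism onto the hyperplane `(ℝ ∙ v)ᗮ`,
which is contractible. [folklore] -/
theorem isSimplyConnected_compl_singleton_sphere (v : Metric.sphere (0 : E) 1) :
    IsSimplyConnected ({v}ᶜ : Set (Metric.sphere (0 : E) 1)) := by
  set e := stereographic (norm_eq_of_mem_sphere v) with he
  have hs : e.source = {v}ᶜ := by simp [he]
  have φ : ({v}ᶜ : Set (Metric.sphere (0 : E) 1)) ≃ₜ (ℝ ∙ (v : E))ᗮ :=
    (((Homeomorph.setCongr hs).symm.trans e.toHomeomorphSourceTarget).trans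
      (Homeomorph.setCongr (stereographic_target _))).trans (Homeomorph.Set.univ _)
  exact φ.toHomotopyEquiv.simplyConnectedSpace

/-- The complement of two antipodal points `v`, `-v` in the unit sphere `Sⁿ` of an
`(n + 1)`-dimensional real inner product space is path connected if `2 ≤ n`: it is the image under
the inverse stereographic projection from `v` of `(ℝ ∙ v)ᗮ ∖ {0}` (the projection sends `-v` to
`0`), and the complement of a point in a real vector space of dimension `n ≥ 2` is path connected.
[folklore] -/
theorem isPathConnected_compl_pair_sphere {n : ℕ} [Fact (Module.finrank ℝ E = n + 1)]
    (hn : 2 ≤ n) (v : Metric.sphere (0 : E) 1) :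
    IsPathConnected ({v}ᶜ ∩ {-v}ᶜ : Set (Metric.sphere (0 : E) 1)) := by
  set e := stereographic (norm_eq_of_mem_sphere v) with he
  have hs : e.source = {v}ᶜ := by simp [he]
  have hrank : 1 < Module.rank ℝ (ℝ ∙ (v : E))ᗮ := by
    apply Module.one_lt_rank_of_one_lt_finrank
    rw [Submodule.finrank_orthogonal_span_singleton (𝕜 := ℝ) (n := n) (ne_zero_of_mem_unit_sphere v)]
    exact hn
  have hpc : IsPathConnected ({0}ᶜ : Set (ℝ ∙ (v : E))ᗮ) :=
    isPathConnected_compl_singleton_of_one_lt_rank hrank 0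
  have hev : e (-v) = 0 := stereographic_apply_neg v
  have himage : e.symm '' {0}ᶜ = {v}ᶜ ∩ {-v}ᶜ := by
    ext x
    constructor
    · rintro ⟨w, hw, rfl⟩
      have hwt : w ∈ e.target := by simp [he]
      have hx : e.symm w ∈ e.source := e.map_target hwt
      refine ⟨hs ▸ hx, fun hx' => hw ?_⟩
      rw [mem_singleton_iff] at hx' ⊢
      rw [← e.right_inv hwt, hx', hev]
    · rintro ⟨hxv, hxnv⟩
      have hx : x ∈ e.source := hs ▸ hxv
      have hnv : -v ∈ e.source := by
        rw [hs]
        exact fun h => (ne_neg_of_mem_unit_sphere ℝ v) (mem_singleton_iff.mp h).symm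
      refine ⟨e x, fun h0 => hxnv ?_, e.left_inv hx⟩
      rw [mem_singleton_iff] at h0 ⊢
      exact e.injOn hx hnv (h0.trans hev.symm)
  rw [← himage]
  exact hpc.image' (e.continuousOn_symm.mono fun _ _ => by simp [he])

/-- **Hatcher 2002, Prop. 1.14**: the unit sphere `Sⁿ` of an `(n + 1)`-dimensional real inner
product space is simply connected for `n ≥ 2`. Proof as printed: cover `Sⁿ` by the complements
of two antipodal points, each homeomorphic to `ℝⁿ` (stereographic projection), whose intersection
`≅ ℝⁿ ∖ {0}` is path connected for `n ≥ 2`, and apply Lemma 1.15.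
[cite: HatcherAT2002, Prop. 1.14] -/
theorem simplyConnectedSpace_sphere {n : ℕ} [Fact (Module.finrank ℝ E = n + 1)] (hn : 2 ≤ n) :
    SimplyConnectedSpace (Metric.sphere (0 : E) 1) := by
  haveI : Nontrivial E :=
    Module.nontrivial_of_finrank_eq_succ (Fact.out : Module.finrank ℝ E = n + 1)
  obtain ⟨v₀, hv₀⟩ := (NormedSpace.sphere_nonempty (x := (0 : E)) (r := (1 : ℝ))).mpr zero_le_one
  set v : Metric.sphere (0 : E) 1 := ⟨v₀, hv₀⟩
  set e := stereographic (norm_eq_of_mem_sphere v) with he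
  have hs : e.source = {v}ᶜ := by simp [he]
  have hev : e (-v) = 0 := stereographic_apply_neg v
  -- a base point away from `v` and `-v`
  obtain ⟨w, hw⟩ : ∃ w : (ℝ ∙ (v : E))ᗮ, w ≠ 0 := by
    haveI : Nontrivial (ℝ ∙ (v : E))ᗮ := by
      apply Module.nontrivial_of_finrank_pos (R := ℝ)
      rw [Submodule.finrank_orthogonal_span_singleton (𝕜 := ℝ) (n := n) (ne_zero_of_mem_unit_sphere v)]
      omega
    exact exists_ne 0
  have hwt : w ∈ e.target := by simp [he]
  set x₀ := e.symm w with hx₀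
  have hx₀v : x₀ ∈ ({v}ᶜ : Set _) := hs ▸ e.map_target hwt
  have hx₀nv : x₀ ∈ ({-v}ᶜ : Set _) := by
    intro h
    rw [mem_singleton_iff] at h
    apply hw
    rw [← e.right_inv hwt, ← hx₀, h, hev]
  -- the cover by the complements of `v` and `-v`
  set c : Bool → Set (Metric.sphere (0 : E) 1) := fun b => {cond b v (-v)}ᶜ with hc
  have hvv : v ≠ -v := ne_neg_of_mem_unit_sphere ℝ v
  refine simplyConnectedSpace_of_isOpen_cover (c := c) (x₀ := x₀) (fun b => isOpen_compl_singleton)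
    ?_ (fun b => ?_) (fun b b' => ?_) (fun b => ?_)
  · refine eq_univ_of_forall fun x => mem_iUnion.mpr ?_
    by_cases hx : x = v
    · exact ⟨false, by simpa [hc, hx] using hvv⟩
    · exact ⟨true, hx⟩
  · cases b
    exacts [isSimplyConnected_compl_singleton_sphere (-v), isSimplyConnected_compl_singleton_sphere v]
  · cases b <;> cases b'
    · simpa [hc] using (isSimplyConnected_compl_singleton_sphere (-v)).isPathConnected
    · simpa [hc, inter_comm] using isPathConnected_compl_pair_sphere hn v
    · simpa [hc] using isPathConnected_compl_pair_sphere hn v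
    · simpa [hc] using (isSimplyConnected_compl_singleton_sphere v).isPathConnected
  · cases b
    exacts [hx₀nv, hx₀v]

/-- **Hatcher 2002, Prop. 1.14** for the standard sphere: `Sⁿ ⊂ ℝⁿ⁺¹ = EuclideanSpace ℝ (Fin (n+1))`
is simply connected for `2 ≤ n`. This is the statement of the named fact
`Literature.Riemannian.sphere_simplyConnected` (`Literature/Geometry/Riemannian/KuiperProofs.lean`).
[cite: HatcherAT2002, Prop. 1.14] -/
theorem simplyConnectedSpace_euclideanSphere (n : ℕ) (hn : 2 ≤ n) :
    SimplyConnectedSpace (Metric.sphere (0 : EuclideanSpace ℝ (Fin (n + 1))) 1) :=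
  haveI := Fact.mk (@finrank_euclideanSpace_fin ℝ _ (n + 1))
  simplyConnectedSpace_sphere hn

end Sphere

end Literature.AlgebraicTopology.FundamentalGroup

end
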